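import Summits.ValiantsHypothesis.ValiantsHypothesis.Theorems.BarrierLeverTransversalMinorLayoutsRelabel
import Summits.ValiantsHypothesis.ValiantsHypothesis.Theorems.BarrierLeverTransversalMinorLayoutsClaws
import Summits.ValiantsHypothesis.ValiantsHypothesis.Theorems.BarrierLeverTransversalMinorLayoutsPathSix
import Summits.ValiantsHypothesis.ValiantsHypothesis.Theorems.BarrierLeverTransversalMinorLayoutsLockedCertsSix

/-!
# Route BarrierLever — conjecture TT (`TransversalMinorLayoutsNonsingular`, stmt-ValiantsHypothesis-19152):
# TT for layouts with at most SIX rows, every height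

Helper file (`--supports stmt-ValiantsHypothesis-19152`; cell valiant-natproofs, rung V4, 𝒟-side of
door (c); seat val-np-p1 gen 8).  The bounded locked-complex engine
(`FiniteCheck.tt_rank_le_of_lockedCore`, file `…FiniteCheck`) reduces TT for `r ≤ 6` rows to the
LOCKED pairs of complexes (injective lower-set layouts) with `r ≤ 6` faces at heights `h < r`;
beyond the tree's `h ≤ 3` theorem and the empty cell `(4, 5)` (`…RankFive`) this leaves the cells
`(h, r) = (4, 6)` and `(5, 6)`.  Complexes with `< 8` faces are graphs (faces of size `≤ 2`), and a
locked pair has a side using every coordinate (`full_or_full_of_locked`, `…Claws`), so: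

* `(5, 6)` (`good_claw_path_h5`): the full side is the `5`-CLAW (every coordinate has degree
  `1`, `degree_eq_one_of_claw`), so the other side has no vertex of degree `1`, which for six faces
  forces the PATH `{∅, {a}, {b}, {c}, {a,b}, {a,c}}` (`lowerFamily_six_eq_path`, `…PathSix`); the
  kernel certificate `claw5_v_path3_h5_derivable` (`…LockedCertsSix`), transported along the
  coordinate relabeling `a, b, c ↦ 0, 1, 2` (`good_of_ppDerivable_relabel`, `…Relabel`) settles it,
  and the row/column swap (`tt_layout_swap`) covers the mirror case;
* `(4, 6)`: the full side is the `4`-claw plus one edge (degrees `2` and `1` occur,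
  `exists_degree_two_one_of_claw_edge`), the other side has a vertex of degree `1` or is a path
  with a vertex of degree `2` — never locked.

Main result: `transversalMinorLayouts_nonsingular_of_r_le_six` — **item 19152's conclusion for
every injective layout pair with `r ≤ 6` rows, at every height.**  For `r = 7` the locked cells are
`(4,7)`, `(5,7)`, `(6,7)` with four certificate types (matching / triangle against claws); not
treated here.

WHAT THIS IS NOT: a bounded-rank slice of TT; nothing on TT / item 19761 in general, on crux
stmt-ValiantsHypothesis-14610, or on `VP` versus `VNP`.
-/

-- layout Summits/ValiantsHypothesis/ValiantsHypothesis forces the duplicated namespace component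
set_option linter.dupNamespace false

open Matrix Finset

namespace Summit.ValiantsHypothesis.ValiantsHypothesis.Theorems.BarrierLever.FiniteCheck

open Summit.ValiantsHypothesis.ValiantsHypothesis.Theorems.BarrierLever.Compression
open Summit.ValiantsHypothesis.ValiantsHypothesis.Theorems.BarrierLever.PriorityPeeling

/-! ## 4. The locked cells with six faces -/

/-- **Cell `(5, 6)`.**  A `5`-claw `u` (six faces using all five coordinates) against a six-face
complex `w` without a vertex of degree one is GOOD: `w` is a path `{∅, a, b, c, ab, ac}`, and the
kernel certificate `claw5_v_path3_h5_derivable` transports along the coordinate relabeling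
`a, b, c ↦ 0, 1, 2` (`Equiv.Perm.exists_extending_pair`). -/
theorem good_claw_path_h5 (u w : Fin 6 → Finset (Fin 5)) (hu : Function.Injective u)
    (hw : Function.Injective w) (hlu : IsLowerSet (Set.range u)) (hlw : IsLowerSet (Set.range w))
    (hfull : ∀ a : Fin 5, ∃ i, a ∈ u i)
    (hdeg : ∀ c : Fin 5, (Finset.univ.filter fun j => c ∈ w j).card ≠ 1) :
    ∃ H : Matrix (Fin (5 + 5)) (Fin (5 + 5)) ℂ, (Matrix.of fun i j : Fin 6 => (H.submatrix
      (fun a : Fin 5 => if a ∈ u i then Fin.castAdd 5 a else Fin.natAdd 5 a)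
      (fun c : Fin 5 => if c ∈ w j then Fin.natAdd 5 c else Fin.castAdd 5 c)).det).det ≠ 0 := by
  classical
  -- the column family is a path
  have hlow : ∀ x ∈ Finset.univ.image w, ∀ t, t ⊆ x → t ∈ Finset.univ.image w := by
    intro x hx t ht
    obtain ⟨i, _, rfl⟩ := Finset.mem_image.mp hx
    obtain ⟨j, hj⟩ := hlw ht ⟨i, rfl⟩
    exact Finset.mem_image.mpr ⟨j, Finset.mem_univ _, hj⟩
  have hcard : (Finset.univ.image w).card = 6 := by
    rw [Finset.card_image_of_injective _ hw, Finset.card_univ, Fintype.card_fin]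
  have hdeg' : ∀ c : Fin 5, ((Finset.univ.image w).filter fun x => c ∈ x).card ≠ 1 := by
    intro c
    rw [Finset.filter_image, Finset.card_image_of_injective _ hw]
    exact hdeg c
  obtain ⟨a, b, c, hab, hac, hbc, -, -, hF⟩ := lowerFamily_six_eq_path _ hlow hcard hdeg'
  -- the relabeling a, b, c ↦ 0, 1, 2
  have hinj : Function.Injective (![a, b, c] : Fin 3 → Fin 5) := by
    intro x y hxy
    fin_cases x <;> fin_cases y <;> simp_all [Fin.ext_iff]
  obtain ⟨π', hπ'⟩ := Equiv.Perm.exists_extending_pair (![a, b, c] : Fin 3 → Fin 5)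
    (![0, 1, 2] : Fin 3 → Fin 5) hinj (by decide)
  have hπa : π' a = 0 := hπ' 0
  have hπb : π' b = 1 := hπ' 1
  have hπc : π' c = 2 := hπ' 2
  refine good_of_ppDerivable_relabel u w _ _ hu hw (Equiv.refl _) π' ?_ ?_ claw5_v_path3_h5_derivable
  · -- rows: ∅ and singletons are faces of the standard claw
    intro i
    have hi := face_card_le_one_of_claw u hu hlu hfull rfl i
    rw [Equiv.refl_toEmbedding, Finset.map_refl]
    rcases Nat.lt_or_ge (u i).card 1 with h0 | h1
    · rw [Finset.card_eq_zero.mp (show (u i).card = 0 by omega)]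
      exact ⟨0, rfl⟩
    · obtain ⟨x, hx⟩ := Finset.card_eq_one.mp (le_antisymm hi h1)
      rw [hx]
      exact (by decide : ∀ x : Fin 5, ∃ i' : Fin 6,
        ({x} : Finset (Fin 5)) = (![∅, {0}, {1}, {2}, {3}, {4}] : Fin 6 → Finset (Fin 5)) i') x
  · -- columns: the path's faces relabel to the standard path's faces
    intro j
    have hj := hF (w j) (Finset.mem_image.mpr ⟨j, Finset.mem_univ _, rfl⟩)
    rcases hj with e | e | e | e | e | e <;> rw [e]
    · exact ⟨0, by simp⟩
    · exact ⟨1, by simp [hπa]⟩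
    · exact ⟨2, by simp [hπb]⟩
    · exact ⟨3, by simp [hπc]⟩
    · exact ⟨4, by simp [Finset.map_insert, hπa, hπb]⟩
    · exact ⟨5, by simp [Finset.map_insert, hπa, hπc]⟩

/-! ## 5. Six rows -/

/-- **TT for `r ≤ 6` rows, every `h`** (conclusion of item 19152 verbatim for these layouts).  By
the bounded engine only locked pairs of complexes with `r ≤ 6` faces at heights `3 < h < r` need
attention: `(4, 5)` and `(4, 6)` have none (degree-one / degree-two clashes), and `(5, 6)` is the
claw–path pair of `good_claw_path_h5`, in either order (`tt_layout_swap`). -/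
theorem transversalMinorLayouts_nonsingular_of_r_le_six (h r : ℕ) (hr : r ≤ 6)
    (u w : Fin r → Finset (Fin h)) (hu : Function.Injective u) (hw : Function.Injective w) :
    ∃ H : Matrix (Fin (h + h)) (Fin (h + h)) ℂ, (Matrix.of fun i j : Fin r => (H.submatrix
      (fun a : Fin h => if a ∈ u i then Fin.castAdd h a else Fin.natAdd h a)
      (fun c : Fin h => if c ∈ w j then Fin.natAdd h c else Fin.castAdd h c)).det).det ≠ 0 := by
  classical
  refine tt_rank_le_of_lockedCore 6 (fun h r hr hhr u w hu hw hlu hlw hlk => ?_) h r hr u w hu hw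
  by_cases hh : h ≤ 3
  · exact PPSmall.transversalMinorLayouts_nonsingular_of_le_three h r hh u w hu hw
  by_cases hr5 : r = 5
  · exfalso
    subst hr5
    obtain ⟨a, ha⟩ := exists_degree_one_of_five u hu hlu
    obtain ⟨c, hc⟩ := exists_degree_one_of_five w hw hlw
    apply hlk a c true true
    simp only [iff_true]
    rw [ha, hc]
  have hr6 : r = 6 := by omega
  subst hr6
  -- the full side is a claw (h = 5) or a claw plus an edge (h = 4)
  have key : ∀ (u w : Fin 6 → Finset (Fin h)), Function.Injective u → Function.Injective w →
      IsLowerSet (Set.range u) → IsLowerSet (Set.range w) →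
      (∀ (a c : Fin h) (β γ : Bool),
        (Finset.univ.filter fun i => (a ∈ u i ↔ β = true)).card ≠
          (Finset.univ.filter fun j => (c ∈ w j ↔ γ = true)).card) →
      (∀ a : Fin h, ∃ i, a ∈ u i) →
      ∃ H : Matrix (Fin (h + h)) (Fin (h + h)) ℂ, (Matrix.of fun i j : Fin 6 => (H.submatrix
        (fun a : Fin h => if a ∈ u i then Fin.castAdd h a else Fin.natAdd h a)
        (fun c : Fin h => if c ∈ w j then Fin.natAdd h c else Fin.castAdd h c)).det).det ≠ 0 := by
    intro u w hu hw hlu hlw hlk hfull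
    -- degrees equal on both sides are excluded
    have hclash : ∀ (a c : Fin h), (Finset.univ.filter fun i => a ∈ u i).card ≠
        (Finset.univ.filter fun j => c ∈ w j).card := by
      intro a c e
      apply hlk a c true true
      simp only [iff_true]
      exact e
    by_cases h5 : h = 5
    · subst h5
      have hdu := degree_eq_one_of_claw u hu hlu hfull rfl
      exact good_claw_path_h5 u w hu hw hlu hlw hfull (fun c hc => hclash 0 c (by rw [hdu, hc]))
    · exfalso
      have h4 : h = 4 := by omega
      subst h4
      obtain ⟨p, x, hp, hx⟩ := exists_degree_two_one_of_claw_edge u hu hlu hfull rfl (by norm_num)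
        (by norm_num)
      -- w has no vertex of degree one, hence is a path, with a vertex of degree two
      have hloww : ∀ y ∈ Finset.univ.image w, ∀ t, t ⊆ y → t ∈ Finset.univ.image w := by
        intro y hy t ht
        obtain ⟨i, _, rfl⟩ := Finset.mem_image.mp hy
        obtain ⟨j, hj⟩ := hlw ht ⟨i, rfl⟩
        exact Finset.mem_image.mpr ⟨j, Finset.mem_univ _, hj⟩
      have hcardw : (Finset.univ.image w).card = 6 := by
        rw [Finset.card_image_of_injective _ hw, Finset.card_univ, Fintype.card_fin]
      have hdegw : ∀ c : Fin 4, ((Finset.univ.image w).filter fun y => c ∈ y).card ≠ 1 := by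
        intro c
        rw [Finset.filter_image, Finset.card_image_of_injective _ hw]
        intro hc
        exact hclash x c (by rw [hx]; exact hc.symm)
      obtain ⟨a, b, c, hab, hac, hbc, hbF, habF, hF⟩ :=
        lowerFamily_six_eq_path _ hloww hcardw hdegw
      apply hclash p b
      have e2 : ((Finset.univ.image w).filter fun y => b ∈ y).card =
          (Finset.univ.filter fun j => b ∈ w j).card := by
        rw [Finset.filter_image, Finset.card_image_of_injective _ hw]
      rw [hp, ← e2]
      have : ((Finset.univ.image w).filter fun y => b ∈ y) = {{b}, {a, b}} := by
        ext y
        simp only [Finset.mem_filter, Finset.mem_insert, Finset.mem_singleton]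
        constructor
        · rintro ⟨hy, hby⟩
          rcases hF y hy with rfl | rfl | rfl | rfl | rfl | rfl
          · simp at hby
          · simp only [Finset.mem_singleton] at hby; exact absurd hby.symm hab
          · exact Or.inl rfl
          · simp only [Finset.mem_singleton] at hby; exact absurd hby hbc
          · exact Or.inr rfl
          · simp only [Finset.mem_insert, Finset.mem_singleton] at hby
            rcases hby with e | e
            · exact absurd e.symm hab
            · exact absurd e hbc
        · rintro (rfl | rfl)
          · exact ⟨hbF, by simp⟩
          · exact ⟨habF, by simp⟩
      rw [this, Finset.card_pair]
      intro e
      have : a ∈ ({b} : Finset (Fin 4)) := by rw [e]; simp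
      exact hab (Finset.mem_singleton.mp this)
  rcases full_or_full_of_locked u w hlk with hfu | hfw
  · exact key u w hu hw hlu hlw hlk hfu
  · refine tt_layout_swap h 6 u w (key w u hw hu hlw hlu (fun a c β γ e => hlk c a γ β e.symm) hfw)

end Summit.ValiantsHypothesis.ValiantsHypothesis.Theorems.BarrierLever.FiniteCheck
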